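import Summits.AnomalousDissipation.AnomalousDissipation.Theorems.SolenoidalFractalHomogenisationLagrangianStepVmodDistortedTestPairing
import HarnessLib

/-!
# K1L_D (stmt-AnomalousDissipation-27980), (ℓ3-A) road A: the distorted weak integrand is integrable from a BOUND on `∂_yG`
# (what `IsModulation.grad_le` gives) — tenure RULING D28-15 (a), part 1/2 (prover ad-k1loc-p3 g11, `--supports 27980 --as helper`)

ANSWER to D28-15 (a): yes — in `IsWeakTensorPassiveVectorDistortedOn.integrable_weakIntegrand_lipschitzField` (`…DistortedDuality` §6, used by
p3's (D-GEN) p722918 through `hGd`) the joint CONTINUITY of `∂_yG` serves only to make the variable-coefficient term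
`(t,x) ↦ 𝓛^{G(t),*}_{𝔹₀} ψ(t)(x)` jointly continuous, hence bounded and measurable on the slab; integrability of `⟪w, ·⟫` against the
`L^∞_t L²_x` solution needs exactly «jointly measurable + bounded» (`integrable_inner_of_bounded`).  Both follow without `hGd`:
(i) MEASURABILITY — every `y`-partial derivative of a jointly continuous scalar field is jointly measurable, being a derivative with parameter
of a continuous map (`measurable_deriv_with_param`; `Torus.partialDeriv e f y = deriv (s ↦ f (y + proj (s•e))) 0`); the summands
`∂_e(𝔹^{G}_{icje} · (∂_cψ)_i)` of `viscAdjVar` are such derivatives of jointly continuous fields (no product rule needed for measurability);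
(ii) BOUNDEDNESS — by the product rule, `|∂_e(𝔹^{G}_{icje}(∂_cψ)_i)| ≤ |𝔹^G|·|∂²ψ| + |∂_e𝔹^G|·|∂ψ|` with `|G| ≤ C` (continuity on the compact
slab), `|∂_yG| ≤ B` (HYPOTHESIS — for the class of record `B = θ·nC`, `IsModulation.grad_le`), `|𝔹₀| ≤ A₀`, and `∂ψ`, `∂²ψ` bounded (jointly
continuous on the slab).
* §1 `measurable_uncurry_partialDeriv_of_continuous`; §2 slab bounds (`exists_bound_entries`, `exists_bound_partialDeriv(₂)_apply`,
  `exists_bound_visc4`); §3 `abs_partialDeriv_conj_mul_le` (the pointwise product-rule bound) and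
  **`integrable_weakIntegrand_lipschitzField_of_gradBound`** — the `hint` of `…DistortedDuality` §2 from `hG1 + hGc + |∂_yG| ≤ B` (no `hGd`).
Part 2/2 (`…VmodDistortedTestPairingClass`): (D-GEN) over `IsFrameModulation` with no regularity hypothesis beyond the class.
`sorry`-free; NOT a proof of any block, of (M_θ), of `stub_Vmod_EHTthg`, of K1L_D or of AD; rung F-D1.A0.
-/

set_option linter.dupNamespace false

noncomputable section

namespace Summit.AnomalousDissipation.AnomalousDissipation.Theorems.SolenoidalFractalHomogenisation.LagrangianStep.CellClauseMod

open Literature.Analysis Literature.Analysis.FluidPDE Literature.Analysis.FunctionSpaces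
open MeasureTheory Set Filter UnitAddTorus Function Topology
open scoped ENNReal NNReal InnerProductSpace

variable {Tw : ℝ} {𝔸 : Torus.Visc4 (Fin 3)} {b : ℝ → VF} {G : ℝ → UnitAddTorus (Fin 3) → Matrix (Fin 3) (Fin 3) ℝ}
  {U : ℝ → ℝ → (V2 →L[ℝ] V2)}

/-! ## §1 Measurability of space derivatives of jointly continuous fields -/

/-- **A `y`-partial derivative of a jointly continuous scalar field on `ℝ × 𝕋³` is jointly measurable** (derivative with parameter of the
continuous map `((t,y),s) ↦ g t (y + proj (s•e))` at `s = 0`). -/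
theorem measurable_uncurry_partialDeriv_of_continuous {g : ℝ → UnitAddTorus (Fin 3) → ℝ} (hg : Continuous (uncurry g)) (e : Fin 3) :
    Measurable (uncurry fun t y => Torus.partialDeriv e (g t) y) := by
  set v : EuclideanSpace ℝ (Fin 3) := EuclideanSpace.single e (1:ℝ) with hv
  have h1 : Continuous fun q : (ℝ × UnitAddTorus (Fin 3)) × ℝ => (q.1.1, q.1.2 + Torus.proj (q.2 • v)) :=
    (continuous_fst.comp continuous_fst).prodMk
      ((continuous_snd.comp continuous_fst).add (Torus.continuous_proj.comp (continuous_snd.smul continuous_const)))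
  have hF : Continuous (uncurry fun (p : ℝ × UnitAddTorus (Fin 3)) (s : ℝ) => g p.1 (p.2 + Torus.proj (s • v))) := hg.comp h1
  have hm := measurable_deriv_with_param hF
  exact hm.comp (measurable_id.prodMk measurable_const)

/-! ## §2 Slab bounds -/

/-- Entries of a jointly continuous matrix field are bounded on `[0,T] × 𝕋³`. -/
theorem exists_bound_entries (hGc : ∀ i j, Continuous (uncurry fun t y => G t y i j)) (T : ℝ) :
    ∃ C : ℝ, 0 ≤ C ∧ ∀ t ∈ Icc 0 T, ∀ y i j, |G t y i j| ≤ C := by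
  have hc : Continuous (uncurry fun t y => (fun i j => G t y i j : Fin 3 → Fin 3 → ℝ)) :=
    continuous_pi fun i => continuous_pi fun j => hGc i j
  obtain ⟨C, hC⟩ := Torus.exists_bound_of_continuous_uncurry hc 0 T
  refine ⟨max C 0, le_max_right _ _, fun t ht y i j => ?_⟩
  have h := hC t ht y
  have h1 : ‖(fun i j => G t y i j : Fin 3 → Fin 3 → ℝ) i‖ ≤ ‖(fun i j => G t y i j : Fin 3 → Fin 3 → ℝ)‖ :=
    norm_le_pi_norm (fun i j => G t y i j : Fin 3 → Fin 3 → ℝ) i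
  have h2 : ‖(fun j => G t y i j : Fin 3 → ℝ) j‖ ≤ ‖(fun j => G t y i j : Fin 3 → ℝ)‖ := norm_le_pi_norm (fun j => G t y i j : Fin 3 → ℝ) j
  rw [Real.norm_eq_abs] at h2
  exact (h2.trans (h1.trans h)).trans (le_max_left _ _)

/-- Components of the first space derivatives of a field with jointly continuous iterated space derivatives are bounded on `[0,T] × 𝕋³`. -/
theorem exists_bound_partialDeriv_apply {ψ : ℝ → VF}
    (hψc : ∀ l : List (Fin 3), Continuous (uncurry fun t y => Torus.iterPartialDeriv l (ψ t) y)) (T : ℝ) :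
    ∃ D : ℝ, 0 ≤ D ∧ ∀ t ∈ Icc 0 T, ∀ y c i, |(Torus.partialDeriv c (ψ t) y) i| ≤ D := by
  have hc : Continuous (uncurry fun t y => (fun c => Torus.partialDeriv c (ψ t) y : Fin 3 → EuclideanSpace ℝ (Fin 3))) :=
    continuous_pi fun c => by
      have h := hψc [c]
      simp only [Torus.iterPartialDeriv_cons, Torus.iterPartialDeriv_nil] at h
      exact h
  obtain ⟨D, hD⟩ := Torus.exists_bound_of_continuous_uncurry hc 0 T
  refine ⟨max D 0, le_max_right _ _, fun t ht y c i => ?_⟩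
  have h := hD t ht y
  have h1 : ‖(fun c => Torus.partialDeriv c (ψ t) y : Fin 3 → EuclideanSpace ℝ (Fin 3)) c‖
      ≤ ‖(fun c => Torus.partialDeriv c (ψ t) y : Fin 3 → EuclideanSpace ℝ (Fin 3))‖ :=
    norm_le_pi_norm (fun c => Torus.partialDeriv c (ψ t) y : Fin 3 → EuclideanSpace ℝ (Fin 3)) c
  have h2 : ‖(Torus.partialDeriv c (ψ t) y) i‖ ≤ ‖Torus.partialDeriv c (ψ t) y‖ := PiLp.norm_apply_le _ i
  rw [Real.norm_eq_abs] at h2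
  exact (h2.trans (h1.trans h)).trans (le_max_left _ _)

/-- Components of the second space derivatives, same hypothesis. -/
theorem exists_bound_partialDeriv₂_apply {ψ : ℝ → VF}
    (hψc : ∀ l : List (Fin 3), Continuous (uncurry fun t y => Torus.iterPartialDeriv l (ψ t) y)) (T : ℝ) :
    ∃ D : ℝ, 0 ≤ D ∧ ∀ t ∈ Icc 0 T, ∀ y e c i, |(Torus.partialDeriv e (Torus.partialDeriv c (ψ t)) y) i| ≤ D := by
  have hc : Continuous (uncurry fun t y =>
      (fun e c => Torus.partialDeriv e (Torus.partialDeriv c (ψ t)) y : Fin 3 → Fin 3 → EuclideanSpace ℝ (Fin 3))) :=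
    continuous_pi fun e => continuous_pi fun c => by
      have h := hψc [e, c]
      simp only [Torus.iterPartialDeriv_cons, Torus.iterPartialDeriv_nil] at h
      exact h
  obtain ⟨D, hD⟩ := Torus.exists_bound_of_continuous_uncurry hc 0 T
  refine ⟨max D 0, le_max_right _ _, fun t ht y e c i => ?_⟩
  have h := hD t ht y
  have h1 : ‖(fun e c => Torus.partialDeriv e (Torus.partialDeriv c (ψ t)) y : Fin 3 → Fin 3 → EuclideanSpace ℝ (Fin 3)) e‖
      ≤ ‖(fun e c => Torus.partialDeriv e (Torus.partialDeriv c (ψ t)) y : Fin 3 → Fin 3 → EuclideanSpace ℝ (Fin 3))‖ :=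
    norm_le_pi_norm (fun e c => Torus.partialDeriv e (Torus.partialDeriv c (ψ t)) y : Fin 3 → Fin 3 → EuclideanSpace ℝ (Fin 3)) e
  have h2 : ‖(fun c => Torus.partialDeriv e (Torus.partialDeriv c (ψ t)) y : Fin 3 → EuclideanSpace ℝ (Fin 3)) c‖
      ≤ ‖(fun c => Torus.partialDeriv e (Torus.partialDeriv c (ψ t)) y : Fin 3 → EuclideanSpace ℝ (Fin 3))‖ :=
    norm_le_pi_norm (fun c => Torus.partialDeriv e (Torus.partialDeriv c (ψ t)) y : Fin 3 → EuclideanSpace ℝ (Fin 3)) c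
  have h3 : ‖(Torus.partialDeriv e (Torus.partialDeriv c (ψ t)) y) i‖ ≤ ‖Torus.partialDeriv e (Torus.partialDeriv c (ψ t)) y‖ :=
    PiLp.norm_apply_le _ i
  rw [Real.norm_eq_abs] at h3
  exact (h3.trans (h2.trans (h1.trans h))).trans (le_max_left _ _)

/-- A bound for the entries of a constant fourth-order tensor. -/
theorem exists_bound_visc4 (𝔹₀ : Torus.Visc4 (Fin 3)) : ∃ A : ℝ, 0 ≤ A ∧ ∀ i a j b', |𝔹₀ i a j b'| ≤ A := by
  refine ⟨‖𝔹₀‖, norm_nonneg _, fun i a j b' => ?_⟩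
  have h1 : ‖𝔹₀ i a j b'‖ ≤ ‖𝔹₀ i a j‖ := norm_le_pi_norm _ b'
  have h2 : ‖𝔹₀ i a j‖ ≤ ‖𝔹₀ i a‖ := norm_le_pi_norm _ j
  have h3 : ‖𝔹₀ i a‖ ≤ ‖𝔹₀ i‖ := norm_le_pi_norm _ a
  have h4 : ‖𝔹₀ i‖ ≤ ‖𝔹₀‖ := norm_le_pi_norm _ i
  rw [Real.norm_eq_abs] at h1
  linarith

/-! ## §3 The weak integrand is integrable from a bound on `∂_yG` -/

section Hint

variable {A T : ℝ} {𝔸' : Torus.Visc4 (Fin 3)} {b' w : ℝ → VF} {w₀ : VF} {ψ : ℝ → VF}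

/-- The pointwise product-rule bound of one summand of `viscAdjVar`: with `|G| ≤ C`, `|∂_yG| ≤ B`, `|𝔹₀| ≤ A₀`, `|∂ψ| ≤ D₁`, `|∂²ψ| ≤ D₂`
(`C, B, A₀ ≥ 0`), `|∂_e(𝔹^{G}_{icje} (∂_cψ)_i)| ≤ 9·C·A₀·C·D₂ + 9·(C·A₀·B + B·A₀·C)·D₁`. -/
theorem abs_partialDeriv_conj_mul_le {Gs : UnitAddTorus (Fin 3) → Matrix (Fin 3) (Fin 3) ℝ} {Ψ : VF}
    (hG1 : ∀ i j, Torus.IsContDiff 1 (fun y => Gs y i j)) (hΨ : Torus.IsSmooth Ψ) (𝔹₀ : Torus.Visc4 (Fin 3))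
    {C B A₀ D₁ D₂ : ℝ} (hC0 : 0 ≤ C) (hB0 : 0 ≤ B) (hA0 : 0 ≤ A₀)
    (hC : ∀ y i j, |Gs y i j| ≤ C) (hB : ∀ y i j e', |Torus.partialDeriv e' (fun y => Gs y i j) y| ≤ B)
    (hA : ∀ i a j b', |𝔹₀ i a j b'| ≤ A₀)
    (hD1 : ∀ y c i, |(Torus.partialDeriv c Ψ y) i| ≤ D₁) (hD2 : ∀ y e c i, |(Torus.partialDeriv e (Torus.partialDeriv c Ψ) y) i| ≤ D₂)
    (i c j e : Fin 3) (x : UnitAddTorus (Fin 3)) :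
    |Torus.partialDeriv e (fun y => Torus.Visc4.conj (Gs y) 𝔹₀ i c j e * (Torus.partialDeriv c Ψ y) i) x|
      ≤ 9 * (C * A₀ * C) * D₂ + 9 * (C * A₀ * B + B * A₀ * C) * D₁ := by
  have h𝔹1 : Torus.IsContDiff 1 (fun y => Torus.Visc4.conj (Gs y) 𝔹₀ i c j e) := Torus.isContDiff_one_conj_entry hG1 𝔹₀ i c j e
  have hΨ1 : Torus.IsContDiff 1 (Torus.partialDeriv c Ψ) := (hΨ.partialDeriv c).isContDiff (by simp)
  have hΨ1i : Torus.IsContDiff 1 (fun y => (Torus.partialDeriv c Ψ y) i) := ((hΨ.partialDeriv c).apply i).isContDiff (by simp)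
  rw [Torus.partialDeriv_mul h𝔹1 hΨ1i, Torus.partialDeriv_apply_coord hΨ1]
  -- the conjugated entry and its derivative
  have hprod : ∀ a b', Torus.IsContDiff 1 (fun y => Gs y c a * 𝔹₀ i a j b' * Gs y e b') := fun a b' => by
    unfold Torus.IsContDiff; exact ((hG1 c a).mul contDiff_const).mul (hG1 e b')
  have hca : ∀ a b', Torus.IsContDiff 1 (fun y => Gs y c a * 𝔹₀ i a j b') := fun a b' => by
    unfold Torus.IsContDiff; exact (hG1 c a).mul contDiff_const
  have hconj : |Torus.Visc4.conj (Gs x) 𝔹₀ i c j e| ≤ 9 * (C * A₀ * C) := by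
    rw [Torus.Visc4.conj_apply]
    refine (Finset.abs_sum_le_sum_abs _ _).trans ?_
    have : ∀ a ∈ (Finset.univ : Finset (Fin 3)), |∑ b', Gs x c a * 𝔹₀ i a j b' * Gs x e b'| ≤ 3 * (C * A₀ * C) := fun a _ => by
      refine (Finset.abs_sum_le_sum_abs _ _).trans ?_
      have : ∀ b' ∈ (Finset.univ : Finset (Fin 3)), |Gs x c a * 𝔹₀ i a j b' * Gs x e b'| ≤ C * A₀ * C := fun b' _ => by
        rw [abs_mul, abs_mul]
        exact mul_le_mul (mul_le_mul (hC x c a) (hA i a j b') (abs_nonneg _) hC0) (hC x e b') (abs_nonneg _) (by positivity)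
      refine (Finset.sum_le_sum this).trans ?_
      simp only [Finset.sum_const, Finset.card_univ, Fintype.card_fin, nsmul_eq_mul]
      push_cast
      linarith
    refine (Finset.sum_le_sum this).trans ?_
    simp only [Finset.sum_const, Finset.card_univ, Fintype.card_fin, nsmul_eq_mul]
    push_cast
    linarith
  have hdconj : |Torus.partialDeriv e (fun y => Torus.Visc4.conj (Gs y) 𝔹₀ i c j e) x| ≤ 9 * (C * A₀ * B + B * A₀ * C) := by
    have e1 : Torus.partialDeriv e (fun y => Torus.Visc4.conj (Gs y) 𝔹₀ i c j e) x =
        ∑ a, ∑ b', ((Gs x c a * 𝔹₀ i a j b') * Torus.partialDeriv e (fun y => Gs y e b') x +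
          (Torus.partialDeriv e (fun y => Gs y c a) x * 𝔹₀ i a j b') * Gs x e b') := by
      rw [show (fun y => Torus.Visc4.conj (Gs y) 𝔹₀ i c j e) = fun y => ∑ a, ∑ b', Gs y c a * 𝔹₀ i a j b' * Gs y e b' from
        funext fun y => Torus.Visc4.conj_apply _ _ _ _ _ _]
      rw [Torus.partialDeriv_finset_sum _ (fun a _ => ?_)]
      · refine Finset.sum_congr rfl fun a _ => ?_
        rw [Torus.partialDeriv_finset_sum _ (fun b' _ => hprod a b')]
        refine Finset.sum_congr rfl fun b' _ => ?_
        rw [Torus.partialDeriv_mul (hca a b') (hG1 e b'), Torus.partialDeriv_mul (hG1 c a) (Torus.isContDiff_const _)]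
        have h0 : Torus.partialDeriv e (fun _ : UnitAddTorus (Fin 3) => 𝔹₀ i a j b') x = 0 := by
          simp [Torus.partialDeriv, Torus.lineDeriv]
        rw [h0, mul_zero, zero_add]
      · unfold Torus.IsContDiff
        exact ContDiff.sum (s := Finset.univ) fun b' _ => hprod a b'
    rw [e1]
    refine (Finset.abs_sum_le_sum_abs _ _).trans ?_
    have : ∀ a ∈ (Finset.univ : Finset (Fin 3)), |∑ b', ((Gs x c a * 𝔹₀ i a j b') * Torus.partialDeriv e (fun y => Gs y e b') x +
        (Torus.partialDeriv e (fun y => Gs y c a) x * 𝔹₀ i a j b') * Gs x e b')| ≤ 3 * (C * A₀ * B + B * A₀ * C) := fun a _ => by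
      refine (Finset.abs_sum_le_sum_abs _ _).trans ?_
      have : ∀ b' ∈ (Finset.univ : Finset (Fin 3)), |(Gs x c a * 𝔹₀ i a j b') * Torus.partialDeriv e (fun y => Gs y e b') x +
          (Torus.partialDeriv e (fun y => Gs y c a) x * 𝔹₀ i a j b') * Gs x e b'| ≤ C * A₀ * B + B * A₀ * C := fun b' _ => by
        refine (abs_add_le _ _).trans (add_le_add ?_ ?_)
        · rw [abs_mul, abs_mul]
          exact mul_le_mul (mul_le_mul (hC x c a) (hA i a j b') (abs_nonneg _) hC0) (hB x e b' e) (abs_nonneg _) (by positivity)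
        · rw [abs_mul, abs_mul]
          exact mul_le_mul (mul_le_mul (hB x c a e) (hA i a j b') (abs_nonneg _) hB0) (hC x e b') (abs_nonneg _) (by positivity)
      refine (Finset.sum_le_sum this).trans ?_
      simp only [Finset.sum_const, Finset.card_univ, Fintype.card_fin, nsmul_eq_mul]
      push_cast
      linarith
    refine (Finset.sum_le_sum this).trans ?_
    simp only [Finset.sum_const, Finset.card_univ, Fintype.card_fin, nsmul_eq_mul]
    push_cast
    linarith
  refine (abs_add_le _ _).trans (add_le_add ?_ ?_)
  · rw [abs_mul]
    exact mul_le_mul hconj (hD2 x e c i) (abs_nonneg _) (by positivity)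
  · rw [abs_mul]
    exact mul_le_mul hdconj (hD1 x c i) (abs_nonneg _) (by positivity)

/-- **`hint` from a BOUND on `∂_yG`** (the `hGd`-free twin of `IsWeakTensorPassiveVectorDistortedOn.integrable_weakIntegrand_lipschitzField`):
the space–time weak integrand `⟪w, ∂ₜψ + (b·∇)ψ + 𝓛^{G,*}_{𝔹₀} ψ⟫ + A⟪b, (w·∇)ψ⟫` is integrable on `(0,T) × 𝕋³` for a time-Lipschitz space-smooth
field `ψ` (all iterated space derivatives jointly continuous) when `G` has `C¹` slices, jointly continuous entries and `|∂_yG| ≤ B` on `[0,T]`. -/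
theorem integrable_weakIntegrand_lipschitzField_of_gradBound (h : Torus.IsWeakTensorPassiveVectorDistortedOn A T 𝔸' b' G w₀ w)
    (hψs : ∀ t, Torus.IsSmooth (ψ t))
    (hψc : ∀ l : List (Fin 3), Continuous (uncurry fun t y => Torus.iterPartialDeriv l (ψ t) y))
    (hψL : ∃ L : ℝ, 0 ≤ L ∧ ∀ t ∈ Icc 0 T, ∀ s ∈ Icc 0 T, ∀ y, ‖ψ t y - ψ s y‖ ≤ L * |t - s|)
    (hG1 : ∀ t i j, Torus.IsContDiff 1 (fun y => G t y i j))
    (hGc : ∀ i j, Continuous (uncurry fun t y => G t y i j))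
    {B : ℝ} (hGb : ∀ t ∈ Icc 0 T, ∀ y i j e', |Torus.partialDeriv e' (fun y => G t y i j) y| ≤ B)
    (𝔹₀ : Torus.Visc4 (Fin 3)) :
    Integrable (fun p : ℝ × UnitAddTorus (Fin 3) =>
      ⟪w p.1 p.2, Torus.timeDeriv ψ p.1 p.2 + Torus.convect (b' p.1) (ψ p.1) p.2 +
          Torus.viscAdjVar (fun y => Torus.Visc4.conj (G p.1 y) 𝔹₀) (ψ p.1) p.2⟫_ℝ +
        A * ⟪b' p.1 p.2, Torus.convect (w p.1) (ψ p.1) p.2⟫_ℝ)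
      (((volume : Measure ℝ).restrict (Ioo 0 T)).prod volume) := by
  have hψ1 : ∀ t, Torus.IsContDiff 1 (ψ t) := fun t => (hψs t).isContDiff (by simp)
  have hψd : ∀ j, Continuous (uncurry fun t x => Torus.partialDeriv j (ψ t) x) := fun j => by simpa using hψc [j]
  -- the variable-coefficient term: jointly measurable …
  set V : ℝ → UnitAddTorus (Fin 3) → EuclideanSpace ℝ (Fin 3) := fun t x => Torus.viscAdjVar (fun y => Torus.Visc4.conj (G t y) 𝔹₀) (ψ t) x
    with hVdef
  have hterm : ∀ i c l e, Measurable (uncurry fun t x =>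
      Torus.partialDeriv e (fun y => Torus.Visc4.conj (G t y) 𝔹₀ i c l e * (Torus.partialDeriv c (ψ t) y) i) x) := by
    intro i c l e
    refine measurable_uncurry_partialDeriv_of_continuous (g := fun t y => Torus.Visc4.conj (G t y) 𝔹₀ i c l e * (Torus.partialDeriv c (ψ t) y) i) ?_ e
    have h1 : Continuous (uncurry fun t y => Torus.Visc4.conj (G t y) 𝔹₀ i c l e) := Torus.continuous_uncurry_conj_entry hGc 𝔹₀ i c l e
    have h2 : Continuous (uncurry fun t y => (Torus.partialDeriv c (ψ t) y) i) := (PiLp.continuous_apply 2 _ i).comp (hψd c)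
    exact h1.mul h2
  have hVm : AEStronglyMeasurable (uncurry V) (((volume : Measure ℝ).restrict (Ioo 0 T)).prod volume) := by
    have e2 : uncurry V = fun p : ℝ × UnitAddTorus (Fin 3) =>
        ∑ j, (∑ i, ∑ c, ∑ e, Torus.partialDeriv e
          (fun y => Torus.Visc4.conj (G p.1 y) 𝔹₀ i c j e * (Torus.partialDeriv c (ψ p.1) y) i) p.2) • EuclideanSpace.single j (1 : ℝ) := by
      funext p; rfl
    rw [e2]
    refine (Finset.measurable_sum _ fun j _ => ?_).aestronglyMeasurable
    have hin : Measurable fun p : ℝ × UnitAddTorus (Fin 3) => ∑ i, ∑ c, ∑ e, Torus.partialDeriv e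
        (fun y => Torus.Visc4.conj (G p.1 y) 𝔹₀ i c j e * (Torus.partialDeriv c (ψ p.1) y) i) p.2 :=
      Finset.measurable_sum _ fun i _ => Finset.measurable_sum _ fun c _ => Finset.measurable_sum _ fun e _ => hterm i c j e
    exact hin.smul_const _
  -- … and bounded on the slab
  obtain ⟨C, hC0, hC⟩ := exists_bound_entries hGc T
  obtain ⟨A₀, hA0, hA⟩ := exists_bound_visc4 𝔹₀
  obtain ⟨D₁, _, hD1⟩ := exists_bound_partialDeriv_apply hψc T
  obtain ⟨D₂, _, hD2⟩ := exists_bound_partialDeriv₂_apply hψc T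
  set K : ℝ := 9 * (C * A₀ * C) * D₂ + 9 * (C * A₀ * B + B * A₀ * C) * D₁ with hK
  have hVb : ∀ t ∈ Ioo 0 T, ∀ x, ‖V t x‖ ≤ 3 * (27 * K) := by
    intro t ht x
    have ht' : t ∈ Icc 0 T := Ioo_subset_Icc_self ht
    have hB0 : 0 ≤ B := (abs_nonneg _).trans (hGb t ht' x 0 0 0)
    have hsum : ∀ j, |∑ i, ∑ c, ∑ e, Torus.partialDeriv e
        (fun y => Torus.Visc4.conj (G t y) 𝔹₀ i c j e * (Torus.partialDeriv c (ψ t) y) i) x| ≤ 27 * K := fun j => by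
      have hb : ∀ i c e, |Torus.partialDeriv e (fun y => Torus.Visc4.conj (G t y) 𝔹₀ i c j e * (Torus.partialDeriv c (ψ t) y) i) x| ≤ K :=
        fun i c e => abs_partialDeriv_conj_mul_le (hG1 t) (hψs t) 𝔹₀ hC0 hB0 hA0 (hC t ht') (hGb t ht') hA (hD1 t ht') (hD2 t ht') i c j e x
      calc |∑ i, ∑ c, ∑ e, Torus.partialDeriv e (fun y => Torus.Visc4.conj (G t y) 𝔹₀ i c j e * (Torus.partialDeriv c (ψ t) y) i) x|
          ≤ ∑ i, |∑ c, ∑ e, Torus.partialDeriv e (fun y => Torus.Visc4.conj (G t y) 𝔹₀ i c j e * (Torus.partialDeriv c (ψ t) y) i) x| :=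
            Finset.abs_sum_le_sum_abs _ _
        _ ≤ ∑ i : Fin 3, ∑ c : Fin 3, ∑ e : Fin 3, K := by
            refine Finset.sum_le_sum fun i _ => (Finset.abs_sum_le_sum_abs _ _).trans (Finset.sum_le_sum fun c _ =>
              (Finset.abs_sum_le_sum_abs _ _).trans (Finset.sum_le_sum fun e _ => hb i c e))
        _ = 27 * K := by simp only [Finset.sum_const, Finset.card_univ, Fintype.card_fin, nsmul_eq_mul]; push_cast; ring
    have e2 : V t x = ∑ j, (∑ i, ∑ c, ∑ e, Torus.partialDeriv e
        (fun y => Torus.Visc4.conj (G t y) 𝔹₀ i c j e * (Torus.partialDeriv c (ψ t) y) i) x) • EuclideanSpace.single j (1 : ℝ) := rfl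
    rw [e2]
    refine (norm_sum_le _ _).trans ?_
    have : ∀ j ∈ (Finset.univ : Finset (Fin 3)), ‖(∑ i, ∑ c, ∑ e, Torus.partialDeriv e
        (fun y => Torus.Visc4.conj (G t y) 𝔹₀ i c j e * (Torus.partialDeriv c (ψ t) y) i) x) • EuclideanSpace.single j (1 : ℝ)‖ ≤ 27 * K :=
      fun j _ => by
        have hs1 : ‖EuclideanSpace.single j (1:ℝ)‖ = 1 := by simp
        rw [norm_smul, hs1, mul_one, Real.norm_eq_abs]
        exact hsum j
    refine (Finset.sum_le_sum this).trans ?_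
    simp only [Finset.sum_const, Finset.card_univ, Fintype.card_fin, nsmul_eq_mul]
    push_cast
    linarith
  have hV : Integrable (fun p : ℝ × UnitAddTorus (Fin 3) => ⟪w p.1 p.2, V p.1 p.2⟫_ℝ) (((volume : Measure ℝ).restrict (Ioo 0 T)).prod volume) :=
    h.integrable_inner_of_bounded hVm hVb
  have e : (fun p : ℝ × UnitAddTorus (Fin 3) =>
      ⟪w p.1 p.2, Torus.timeDeriv ψ p.1 p.2 + Torus.convect (b' p.1) (ψ p.1) p.2 +
          Torus.viscAdjVar (fun y => Torus.Visc4.conj (G p.1 y) 𝔹₀) (ψ p.1) p.2⟫_ℝ +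
        A * ⟪b' p.1 p.2, Torus.convect (w p.1) (ψ p.1) p.2⟫_ℝ) =
      fun p => (⟪w p.1 p.2, Torus.timeDeriv ψ p.1 p.2⟫_ℝ +
        ⟪w p.1 p.2, Torus.convect (b' p.1) (ψ p.1) p.2⟫_ℝ + ⟪w p.1 p.2, V p.1 p.2⟫_ℝ) +
        A * ⟪b' p.1 p.2, Torus.convect (w p.1) (ψ p.1) p.2⟫_ℝ := by
    funext p
    rw [inner_add_right, inner_add_right]
  rw [e]
  exact (((h.integrable_inner_timeDeriv (by simpa using hψc []) hψL).add (h.integrable_inner_convect hψ1 hψd)).add hV).add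
    ((h.integrable_inner_carrier_convect hψ1 hψd).const_mul A)

end Hint

end Summit.AnomalousDissipation.AnomalousDissipation.Theorems.SolenoidalFractalHomogenisation.LagrangianStep.CellClauseMod

end
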